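import Mathlib.LinearAlgebra.FiniteDimensional.Lemmas
import Mathlib.LinearAlgebra.Matrix.Permanent
import Mathlib.Tactic.LinearCombination
import Literature.LinearAlgebra.Matrix.PermanentSubperm
import Literature.Computability.AlgebraicComplexity.AlperBogartVelascoBoxThree
import HarnessLib

/-!
# Linear `3`-spaces of `3 × 3` matrices with vanishing `2 × 2` subpermanents are the lines — lemmas

Topic `Literature/Computability/AlgebraicComplexity`; companion (equality case) of
`AlperBogartVelascoBoxThree.lean` (`finrank_le_three_of_subperm_two_vanish`: a linear subspace `W`
of `3 × 3` matrices on which all nine `2 × 2` subpermanents vanish has `dim W ≤ 3`).  Here: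

* this file: the elementary lemmas of the equality case (`exists_common_index_of_pairings`,
  `quadrics_of_subperm_two_vanish`, `rows_vanish_of_full_row`, `eq_sum_of_full_row`,
  `exists_preimage_single`); the theorem `exists_line_of_subperm_two_vanish` (if moreover
  `dim W ≥ 3` and `2 ≠ 0`, then `W` is supported on ONE ROW or ONE COLUMN) is assembled in
  `AlperBogartVelascoBoxThreeEq.lean`.

This is the linear-subspace shadow of the description of the singular locus of the `3 × 3`
permanent hypersurface ("readily computed, c.f. [von zur Gathen]" in Alper–Bogart–Velasco 2017,
p. 3): `Sing(perm_3) = {all 2 × 2 subpermanents vanish}` is the union of the six linear `3`-spaces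
of matrices supported on a line and nine `3`-dimensional quadric cones (matrices supported on a
`2 × 2` block with `ad + bc = 0`), and the cones contain no linear `3`-space.  It is the extra
input that turns ABV's proof of `dc(perm_3) = 7` into STRUCTURE of the size-`7` representations:
the common zero set `V(I)` of the border forms of a `7 × 7` representation is a `3`-space of this
kind, so the border forms involve exactly the variables of two parallel lines of the grid.

Proof.  With the flag `Y₂ = row₂(W)`, `Y₁ = row₁(W ∩ ker row₂)`, `Y₀ = row₀(W ∩ ker row₁ ∩ ker row₂)`
of the `≤ 3` proof (`dim W = Σ dim Y_p`, and `dim Y_q ≥ 1 ⇒ dim Y_p ≤ 1` for `p ≠ q`), `dim W = 3`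
leaves the profiles `(3,0,0)`, `(0,3,0)`, `(0,0,3)` — then the quadrics between the full row and an
earlier row, evaluated on elements `x_a` with full row `e_a` and on the sums `x_a + x_b`, kill the
earlier row (`λ_a + λ_b = 0` for all `a ≠ b`, so `2λ = 0`), and `W` is a row space — and `(1,1,1)` —
then generators `u, v, w` of the three `Y_p` are pairwise orthogonal for the pairing
`u_c v_{c'} + u_{c'} v_c` (`c ≠ c'`), which (using `2 ≠ 0` twice) forces `u, v, w ∈ K·e_c` for one
column index `c`, and the quadrics inside single elements of `W` push every row into `K·e_c`:
`W` is the column space `c`.  Characteristic `2` is genuinely excluded (`perm = det`).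

## References

* J. Alper, T. Bogart, M. Velasco, *A lower bound for the determinantal complexity of a
  hypersurface*, Found. Comput. Math. 17 (2017) 829–836, arXiv:1505.02205 — Cor. 1.4, p. 3.
* J. von zur Gathen, *Permanent and determinant*, Linear Algebra Appl. 96 (1987) 87–100, §2.
-/

noncomputable section

open Module

namespace Literature.Computability.AlgebraicComplexity

namespace AlperBogartVelasco

variable {K : Type*} [Field K]

/-- Three pairwise "permanent-orthogonal" nonzero vectors of `K³` (`u_c v_{c'} + u_{c'} v_c = 0`
for all `c ≠ c'`, for each of the three pairs) are supported on ONE common coordinate, provided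
`2 ≠ 0`: two nonzero coordinates `u_p, u_q` would force `2 u_q u_r v_p = 0`, hence `u_r = 0`,
`v_r = w_r = 0`, and then `2 u_q v_p w_p = 0`, a contradiction. [folklore] -/
theorem exists_common_index_of_pairings (h2 : (2 : K) ≠ 0) {u v w : Fin 3 → K}
    (hu : u ≠ 0) (hv : v ≠ 0) (hw : w ≠ 0)
    (huv : ∀ c₀ j : Fin 3, j ≠ c₀ → u c₀ * v j + u j * v c₀ = 0)
    (huw : ∀ c₀ j : Fin 3, j ≠ c₀ → u c₀ * w j + u j * w c₀ = 0)
    (hvw : ∀ c₀ j : Fin 3, j ≠ c₀ → v c₀ * w j + v j * w c₀ = 0) :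
    ∃ i : Fin 3, ∀ j, j ≠ i → u j = 0 ∧ v j = 0 ∧ w j = 0 := by
  -- a nonzero coordinate `p` of `u` makes `v p`, `w p` nonzero
  have hvp : ∀ p, u p ≠ 0 → v p ≠ 0 := by
    intro p hp h0
    apply hv
    funext j
    by_cases hj : j = p
    · rw [hj, h0, Pi.zero_apply]
    · have e := huv p j hj
      rw [h0, mul_zero, add_zero] at e
      exact (mul_eq_zero.1 e).resolve_left hp
  have hwp : ∀ p, u p ≠ 0 → w p ≠ 0 := by
    intro p hp h0
    apply hw
    funext j
    by_cases hj : j = p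
    · rw [hj, h0, Pi.zero_apply]
    · have e := huw p j hj
      rw [h0, mul_zero, add_zero] at e
      exact (mul_eq_zero.1 e).resolve_left hp
  -- `u` has a single nonzero coordinate
  have single : ∀ p q : Fin 3, p ≠ q → u p ≠ 0 → u q = 0 := by
    intro p q hpq hp
    by_contra hq
    have aux : ∀ p q : Fin 3, p ≠ q → ∃ r : Fin 3, r ≠ p ∧ r ≠ q := by decide
    obtain ⟨r, hrp, hrq⟩ := aux p q hpq
    have epq := huv p q (Ne.symm hpq)
    have epr := huv p r hrp
    have eqr := huv q r hrq
    have t1 : 2 * u q * u r * v p = 0 := by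
      linear_combination (-(u p)) * eqr + (u q) * epr + (u r) * epq
    have hur : u r = 0 := by
      rcases mul_eq_zero.1 t1 with h | h
      · rcases mul_eq_zero.1 h with h | h
        · exact absurd ((mul_eq_zero.1 h).resolve_left h2) hq
        · exact h
      · exact absurd h (hvp p hp)
    have fpq := huw p q (Ne.symm hpq)
    have gpq := hvw p q (Ne.symm hpq)
    have t2 : 2 * u q * v p * w p = 0 := by
      linear_combination (-(u p)) * gpq + (v p) * fpq + (w p) * epq
    rcases mul_eq_zero.1 t2 with h | h
    · rcases mul_eq_zero.1 h with h | h
      · exact absurd ((mul_eq_zero.1 h).resolve_left h2) hq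
      · exact absurd h (hvp p hp)
    · exact absurd h (hwp p hp)
  obtain ⟨i, hi⟩ : ∃ i, u i ≠ 0 := by
    by_contra hall
    push Not at hall
    exact hu (funext hall)
  refine ⟨i, fun j hj => ?_⟩
  have huj : u j = 0 := single i j (Ne.symm hj) hi
  refine ⟨huj, ?_, ?_⟩
  · have e := huv i j hj
    rw [huj, zero_mul, add_zero] at e
    exact (mul_eq_zero.1 e).resolve_left hi
  · have e := huw i j hj
    rw [huj, zero_mul, add_zero] at e
    exact (mul_eq_zero.1 e).resolve_left hi

/-- The nine vanishing `2 × 2` subpermanents of the elements of `W`, as the quadrics between any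
two rows `p ≠ q` and any two columns `c₀ ≠ j` of ONE element: `x_{p c₀} x_{q j} + x_{p j} x_{q c₀} = 0`.
[cite: AlperBogartVelasco2017, Cor. 1.4] -/
theorem quadrics_of_subperm_two_vanish (W : Submodule K (Fin 3 × Fin 3 → K))
    (hW : ∀ x ∈ W, ∀ r c : Fin 3,
      ((Matrix.of fun i j => x (i, j)).submatrix r.succAbove c.succAbove).permanent = 0) :
    ∀ x ∈ W, ∀ p q : Fin 3, p ≠ q → ∀ c₀ j : Fin 3, j ≠ c₀ →
      x (p, c₀) * x (q, j) + x (p, j) * x (q, c₀) = 0 := by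
  have e00 : (0 : Fin 3).succAbove 0 = 1 := by decide
  have e01 : (0 : Fin 3).succAbove 1 = 2 := by decide
  have e10 : (1 : Fin 3).succAbove 0 = 0 := by decide
  have e11 : (1 : Fin 3).succAbove 1 = 2 := by decide
  have e20 : (2 : Fin 3).succAbove 0 = 0 := by decide
  have e21 : (2 : Fin 3).succAbove 1 = 1 := by decide
  have hQ : ∀ x ∈ W, ∀ r : Fin 3,
      x (r.succAbove 0, 1) * x (r.succAbove 1, 2) + x (r.succAbove 0, 2) * x (r.succAbove 1, 1) = 0 ∧
      x (r.succAbove 0, 0) * x (r.succAbove 1, 2) + x (r.succAbove 0, 2) * x (r.succAbove 1, 0) = 0 ∧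
      x (r.succAbove 0, 0) * x (r.succAbove 1, 1) + x (r.succAbove 0, 1) * x (r.succAbove 1, 0) = 0 := by
    intro x hx r
    have h0 := hW x hx r 0
    have h1 := hW x hx r 1
    have h2 := hW x hx r 2
    rw [Matrix.permanent_fin_two_row] at h0 h1 h2
    simp only [Matrix.submatrix_apply, Matrix.of_apply, e00, e01, e10, e11, e20, e21] at h0 h1 h2
    exact ⟨h0, h1, h2⟩
  intro x hx p q hpq
  have key : ∀ p q : Fin 3, (∃ r : Fin 3, p = r.succAbove 0 ∧ q = r.succAbove 1) →
      ∀ c₀ j : Fin 3, j ≠ c₀ → x (p, c₀) * x (q, j) + x (p, j) * x (q, c₀) = 0 := by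
    rintro p q ⟨r, rfl, rfl⟩
    obtain ⟨a1, a2, a3⟩ := hQ x hx r
    exact pairings_of_three (u := fun c => x (r.succAbove 0, c)) (v := fun c => x (r.succAbove 1, c))
      a3 a2 a1
  rcases fin_three_pairs p q (Ne.symm hpq) with ⟨rfl, rfl⟩ | ⟨rfl, rfl⟩ | ⟨rfl, rfl⟩ | ⟨rfl, rfl⟩ |
    ⟨rfl, rfl⟩ | ⟨rfl, rfl⟩
  · exact key 0 1 ⟨2, e20.symm, e21.symm⟩
  · exact key 0 2 ⟨1, e10.symm, e11.symm⟩
  · intro c₀ j hj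
    linear_combination key 0 1 ⟨2, e20.symm, e21.symm⟩ c₀ j hj
  · exact key 1 2 ⟨0, e00.symm, e01.symm⟩
  · intro c₀ j hj
    linear_combination key 0 2 ⟨1, e10.symm, e11.symm⟩ c₀ j hj
  · intro c₀ j hj
    linear_combination key 1 2 ⟨0, e00.symm, e01.symm⟩ c₀ j hj

/-- **The key computation of the row cases.**  If three elements `x_a` (`a = 0,1,2`) of a set of
matrices closed under addition on which the quadrics hold have row `q` equal to the standard basis
vectors `e_a`, then their rows `p ≠ q` vanish: the off-diagonal entries by the quadric of `x_a`
alone, the diagonal ones `λ_a` from `λ_a + λ_b = 0` (`a ≠ b`, quadric of `x_a + x_b`) and `2 ≠ 0`.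
[folklore] -/
theorem rows_vanish_of_full_row (h2 : (2 : K) ≠ 0) (W : Submodule K (Fin 3 × Fin 3 → K))
    (hQ' : ∀ x ∈ W, ∀ p q : Fin 3, p ≠ q → ∀ c₀ j : Fin 3, j ≠ c₀ →
      x (p, c₀) * x (q, j) + x (p, j) * x (q, c₀) = 0)
    (p q : Fin 3) (hpq : p ≠ q) (xs : Fin 3 → (Fin 3 × Fin 3 → K)) (hxs : ∀ a, xs a ∈ W)
    (hq : ∀ a j, xs a (q, j) = if j = a then 1 else 0) : ∀ a j, xs a (p, j) = 0 := by
  -- off-diagonal entries of row `p` vanish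
  have hoff : ∀ a j, j ≠ a → xs a (p, j) = 0 := by
    intro a j hja
    have e := hQ' (xs a) (hxs a) p q hpq a j hja
    rw [hq a j, hq a a, if_neg hja, if_pos rfl, mul_zero, zero_add, mul_one] at e
    exact e
  -- diagonal entries: `λ_a + λ_b = 0` for `a ≠ b`
  have hdiag : ∀ a b, b ≠ a → xs a (p, a) + xs b (p, b) = 0 := by
    intro a b hba
    have e := hQ' (xs a + xs b) (W.add_mem (hxs a) (hxs b)) p q hpq a b hba
    simp only [Pi.add_apply, hq, if_true, if_neg hba, if_neg (Ne.symm hba),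
      hoff a b hba, hoff b a (Ne.symm hba), add_zero, zero_add, mul_one] at e
    linear_combination e
  intro a j
  by_cases hja : j = a
  · rw [hja]
    have aux : ∀ a : Fin 3, ∃ b c : Fin 3, b ≠ a ∧ c ≠ a ∧ c ≠ b := by decide
    obtain ⟨b, c, hba, hca, hcb⟩ := aux a
    have e1 := hdiag a b hba
    have e2 := hdiag a c hca
    have e3 := hdiag b c hcb
    have : (2 : K) * xs a (p, a) = 0 := by linear_combination e1 + e2 - e3
    exact (mul_eq_zero.1 this).resolve_left h2
  · exact hoff a j hja

/-- Expansion along a full row: if `x_a ∈ S` have row `q` equal to `e_a` and `S` meets the kernel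
of the row-`q` projection trivially, then every `x ∈ S` is `Σ_a x_{q a} • x_a`. [folklore] -/
theorem eq_sum_of_full_row (S : Submodule K (Fin 3 × Fin 3 → K)) (q : Fin 3)
    (xs : Fin 3 → (Fin 3 × Fin 3 → K)) (hxs : ∀ a, xs a ∈ S)
    (hq : ∀ a j, xs a (q, j) = if j = a then 1 else 0)
    (hker : (S ⊓ LinearMap.ker (LinearMap.funLeft K K fun j : Fin 3 => (q, j)) :
      Submodule K _) = ⊥) :
    ∀ x ∈ S, x = ∑ a, x (q, a) • xs a := by
  intro x hx
  have hy : x - ∑ a, x (q, a) • xs a ∈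
      (S ⊓ LinearMap.ker (LinearMap.funLeft K K fun j : Fin 3 => (q, j)) : Submodule K _) := by
    refine Submodule.mem_inf.2 ⟨S.sub_mem hx (S.sum_mem fun a _ => S.smul_mem _ (hxs a)), ?_⟩
    rw [LinearMap.mem_ker]
    funext j
    rw [LinearMap.funLeft_apply, Pi.zero_apply, Pi.sub_apply, Finset.sum_apply]
    simp only [Pi.smul_apply, smul_eq_mul, hq, mul_ite, mul_one, mul_zero, Finset.sum_ite_eq,
      Finset.mem_univ, if_true, sub_self]
  rw [hker, Submodule.mem_bot, sub_eq_zero] at hy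
  exact hy

/-- A full level of the flag: if the row-`p` image of `S` is `3`-dimensional, the standard basis
vectors have preimages in `S`. [folklore] -/
theorem exists_preimage_single (S : Submodule K (Fin 3 × Fin 3 → K)) (p : Fin 3)
    (hS : finrank K (S.map (LinearMap.funLeft K K fun j : Fin 3 => (p, j))) = 3) (a : Fin 3) :
    ∃ x ∈ S, ∀ j, x (p, j) = if j = a then 1 else 0 := by
  have htop : S.map (LinearMap.funLeft K K fun j : Fin 3 => (p, j)) = ⊤ := by
    apply Submodule.eq_top_of_finrank_eq
    rw [hS, finrank_fintype_fun_eq_card, Fintype.card_fin]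
  have hmem : (Pi.single a 1 : Fin 3 → K) ∈ S.map (LinearMap.funLeft K K fun j : Fin 3 => (p, j)) := by
    rw [htop]; exact Submodule.mem_top
  rw [Submodule.mem_map] at hmem
  obtain ⟨x, hx, hxe⟩ := hmem
  refine ⟨x, hx, fun j => ?_⟩
  have := congr_fun hxe j
  rw [LinearMap.funLeft_apply] at this
  rw [this, Pi.single_apply]

/-- Polarised quadrics between two elements: if `x, x' ∈ W` and row `q` of `x` vanishes, then
`x_{p c₀} x'_{q j} + x_{p j} x'_{q c₀} = 0` (`p ≠ q`, `j ≠ c₀`). [folklore] -/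
theorem cross_pairing (W : Submodule K (Fin 3 × Fin 3 → K))
    (hQ' : ∀ x ∈ W, ∀ p q : Fin 3, p ≠ q → ∀ c₀ j : Fin 3, j ≠ c₀ →
      x (p, c₀) * x (q, j) + x (p, j) * x (q, c₀) = 0)
    {p q : Fin 3} (hpq : p ≠ q) {x x' : Fin 3 × Fin 3 → K} (hx : x ∈ W) (hx' : x' ∈ W)
    (hz : ∀ j, x (q, j) = 0) :
    ∀ c₀ j : Fin 3, j ≠ c₀ → x (p, c₀) * x' (q, j) + x (p, j) * x' (q, c₀) = 0 := by
  intro c₀ j hj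
  have e1 := hQ' (x + x') (W.add_mem hx hx') p q hpq c₀ j hj
  have e2 := hQ' x' hx' p q hpq c₀ j hj
  simp only [Pi.add_apply] at e1
  linear_combination e1 - e2 - (x (p, c₀) + x' (p, c₀)) * hz j - (x (p, j) + x' (p, j)) * hz c₀

end AlperBogartVelasco

end Literature.Computability.AlgebraicComplexity
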